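import Mathlib

/-!
# Axial quadratic rigidity (stub S2q of line `axis-sectors`, crux `MomentParity.QuarticGate`):
# the block-killing lemmas, complexified

Pure vector algebra on `Fin 3 → ℂ` (with integer wavevectors cast to `ℂ`), used by the finite
linear algebra of the quadratic Casimir classification (`…AxialQuadCentre`, `…AxialQuadOff`).
For a pair of wavevectors `(a, b)` with `k = a + b`, transverse amplitudes `x ⊥ a`, `y ⊥ b` feed the
mode `k` only through the PAIR TRANSFERS `(x·b) y + (y·a) x`.

* `eq_zero_of_forall_pair_transfer_complex` — for `a × b` non-isotropic and `a·a ≠ b·b`, a vector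
  `v ⊥ a + b` annihilating all pair transfers vanishes (complex version of
  `QuarticGate.Negative.SelectionRule.eq_zero_of_forall_pair_transfer`, same proof);
* `matrix_eq_zero_of_forall_pair_transfer` — block form: a `3 × 3` complex block `M` with
  `(a+b)ᵀ M = 0`, `M c = 0`, killed by all pair transfers of an unequal non-collinear integer pair
  on the left and transverse vectors `w ⊥ c` on the right, is zero;
* `normal_dotProduct_mulVec_eq_zero_of_eq_len` — EQUAL lengths `|a| = |b|`: the pair transfers still
  contain the polarisation `n = a × b`, so `nᵀ M w = 0`;
* `mulVec_eq_zero_of_three_normals` — three independent left annihilators kill `M w`.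
-/

namespace Summit.AnomalousDissipation.AnomalousDissipation.Theorems.MomentParityQuarticGate.AxialQuad

open Matrix

-- `Summit.<Summit>.<Problem>` is the tree's mandated summit-side namespace (CONVENTIONS §2); for this
-- single-conjunct summit the two coincide, so the duplicate is deliberate.
set_option linter.dupNamespace false

/-! ## Casting integer vectors to `ℂ³` -/

/-- `↑(k + l) = ↑k + ↑l`. [folklore] -/
theorem castVec_add (k l : Fin 3 → ℤ) : (fun i : Fin 3 => ((((k + l) : Fin 3 → ℤ) i : ℤ) : ℂ)) = (fun i : Fin 3 => (((k : Fin 3 → ℤ) i : ℤ) : ℂ)) + (fun i : Fin 3 => (((l : Fin 3 → ℤ) i : ℤ) : ℂ)) := by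
  funext i; simp

/-- `↑(-k) = -↑k`. [folklore] -/
theorem castVec_neg (k : Fin 3 → ℤ) : (fun i : Fin 3 => ((((-k) : Fin 3 → ℤ) i : ℤ) : ℂ)) = -(fun i : Fin 3 => (((k : Fin 3 → ℤ) i : ℤ) : ℂ)) := by
  funext i; simp

/-- `↑(k - l) = ↑k - ↑l`. [folklore] -/
theorem castVec_sub (k l : Fin 3 → ℤ) : (fun i : Fin 3 => ((((k - l) : Fin 3 → ℤ) i : ℤ) : ℂ)) = (fun i : Fin 3 => (((k : Fin 3 → ℤ) i : ℤ) : ℂ)) - (fun i : Fin 3 => (((l : Fin 3 → ℤ) i : ℤ) : ℂ)) := by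
  funext i; simp

/-- `↑(n • k) = n • ↑k`. [folklore] -/
theorem castVec_zsmul (n : ℤ) (k : Fin 3 → ℤ) : (fun i : Fin 3 => ((((n • k) : Fin 3 → ℤ) i : ℤ) : ℂ)) = (n : ℂ) • (fun i : Fin 3 => (((k : Fin 3 → ℤ) i : ℤ) : ℂ)) := by
  funext i; simp

/-- `↑0 = 0`. [folklore] -/
theorem castVec_zero : (fun i : Fin 3 => ((((0 : Fin 3 → ℤ) : Fin 3 → ℤ) i : ℤ) : ℂ)) = 0 := by
  funext i; simp

/-- The cast is injective. [folklore] -/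
theorem castVec_injective {k l : Fin 3 → ℤ} (h : (fun i : Fin 3 => (((k : Fin 3 → ℤ) i : ℤ) : ℂ)) = (fun i : Fin 3 => (((l : Fin 3 → ℤ) i : ℤ) : ℂ))) : k = l := by
  funext i; exact_mod_cast congrFun h i

/-- `↑k = 0 ↔ k = 0`. [folklore] -/
theorem castVec_eq_zero_iff (k : Fin 3 → ℤ) : (fun i : Fin 3 => (((k : Fin 3 → ℤ) i : ℤ) : ℂ)) = 0 ↔ k = 0 :=
  ⟨fun h => castVec_injective (by rw [h, castVec_zero]), fun h => by rw [h, castVec_zero]⟩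

/-- Dot products commute with the cast. [folklore] -/
theorem castVec_dotProduct_castVec (k l : Fin 3 → ℤ) : (fun i : Fin 3 => (((k : Fin 3 → ℤ) i : ℤ) : ℂ)) ⬝ᵥ (fun i : Fin 3 => (((l : Fin 3 → ℤ) i : ℤ) : ℂ)) = ((k ⬝ᵥ l : ℤ) : ℂ) := by
  simp [dotProduct, Fin.sum_univ_three]

/-- Cross products commute with the cast. [folklore] -/
theorem castVec_cross_castVec (k l : Fin 3 → ℤ) : (fun i : Fin 3 => (((k : Fin 3 → ℤ) i : ℤ) : ℂ)) ⨯₃ (fun i : Fin 3 => (((l : Fin 3 → ℤ) i : ℤ) : ℂ)) = (fun i : Fin 3 => ((((k ⨯₃ l) : Fin 3 → ℤ) i : ℤ) : ℂ)) := by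
  funext i; fin_cases i <;> simp [cross_apply]

/-- A nonzero integer vector has positive self dot product. [folklore] -/
theorem dotProduct_self_pos_of_ne_zero_int {n : Fin 3 → ℤ} (hn : n ≠ 0) : 0 < n ⬝ᵥ n := by
  rw [vec3_dotProduct]
  by_contra hle
  push Not at hle
  have h0 : n 0 = 0 := by nlinarith [sq_nonneg (n 0), sq_nonneg (n 1), sq_nonneg (n 2)]
  have h1 : n 1 = 0 := by nlinarith [sq_nonneg (n 0), sq_nonneg (n 1), sq_nonneg (n 2)]
  have h2 : n 2 = 0 := by nlinarith [sq_nonneg (n 0), sq_nonneg (n 1), sq_nonneg (n 2)]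
  exact hn (funext fun i => by fin_cases i <;> assumption)

/-- The complexified self dot product of a nonzero integer vector is nonzero. [folklore] -/
theorem castVec_dotProduct_self_ne_zero {n : Fin 3 → ℤ} (hn : n ≠ 0) : (fun i : Fin 3 => (((n : Fin 3 → ℤ) i : ℤ) : ℂ)) ⬝ᵥ (fun i : Fin 3 => (((n : Fin 3 → ℤ) i : ℤ) : ℂ)) ≠ 0 := by
  rw [castVec_dotProduct_castVec]
  exact_mod_cast (dotProduct_self_pos_of_ne_zero_int hn).ne'

/-! ## The block-killing lemma over `ℂ` -/

/-- **Block-killing lemma, complex form.** For `a, b ∈ ℂ³` with `(a × b)·(a × b) ≠ 0` and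
`a·a ≠ b·b`, a vector `v ⊥ a + b` (bilinear dot product) annihilating every pair transfer
`(x·b) y + (y·a) x` (`x ⊥ a`, `y ⊥ b`) vanishes: with `n = a × b` the transfers contain `(n·n) n` and
`(n·n) (a − b) × n`, and `{a + b, n, (a − b) × n}` has determinant `(n·n)(a·a − b·b) ≠ 0`. [folklore] -/
theorem eq_zero_of_forall_pair_transfer_complex (a b v : Fin 3 → ℂ)
    (hn : (a ⨯₃ b) ⬝ᵥ (a ⨯₃ b) ≠ 0) (hlen : a ⬝ᵥ a ≠ b ⬝ᵥ b) (hv : v ⬝ᵥ (a + b) = 0)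
    (h : ∀ x y : Fin 3 → ℂ, x ⬝ᵥ a = 0 → y ⬝ᵥ b = 0 → v ⬝ᵥ ((x ⬝ᵥ b) • y + (y ⬝ᵥ a) • x) = 0) :
    v = 0 := by
  -- adapted from QuarticGate.Negative.SelectionRule.eq_zero_of_forall_pair_transfer (real version)
  set n : Fin 3 → ℂ := a ⨯₃ b with hndef
  have hna : n ⬝ᵥ a = 0 := by rw [hndef, dotProduct_comm]; exact dot_self_cross a b
  have hnb : n ⬝ᵥ b = 0 := by rw [hndef, dotProduct_comm]; exact dot_cross_self a b
  have hxa : (a ⨯₃ n) ⬝ᵥ a = 0 := by rw [dotProduct_comm]; exact dot_self_cross a n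
  have hyb : (b ⨯₃ n) ⬝ᵥ b = 0 := by rw [dotProduct_comm]; exact dot_self_cross b n
  have habn : (b ⨯₃ n) ⬝ᵥ a = n ⬝ᵥ n := by
    rw [dotProduct_comm, triple_product_permutation, triple_product_permutation, hndef]
  have hban : (a ⨯₃ n) ⬝ᵥ b = -(n ⬝ᵥ n) := by
    rw [dotProduct_comm, triple_product_permutation, triple_product_permutation, hndef,
      ← cross_anticomm a b, dotProduct_neg]
  -- step 1: `x = n`, `y = b × n` gives `v·n = 0`
  have h1 := h n (b ⨯₃ n) hna hyb
  rw [hnb, zero_smul, zero_add, habn, dotProduct_smul, smul_eq_mul] at h1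
  have hvn : v ⬝ᵥ n = 0 := by
    rcases mul_eq_zero.1 h1 with h' | h'
    · exact absurd h' hn
    · exact h'
  -- step 2: `x = a × n`, `y = b × n` gives `v·((a−b)×n) = 0`
  have h2 := h (a ⨯₃ n) (b ⨯₃ n) hxa hyb
  rw [hban, habn, neg_smul, ← sub_eq_neg_add, ← smul_sub, dotProduct_smul, smul_eq_mul] at h2
  set w : Fin 3 → ℂ := a ⨯₃ n - b ⨯₃ n with hwdef
  have hw : w = (a - b) ⨯₃ n := by rw [hwdef, LinearMap.map_sub₂]
  have hvw : v ⬝ᵥ w = 0 := by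
    rcases mul_eq_zero.1 h2 with h' | h'
    · exact absurd h' hn
    · exact h'
  -- step 3: `{a+b, n, (a−b)×n}` is a basis: det = (n·n)(a·a − b·b) ≠ 0
  set M : Matrix (Fin 3) (Fin 3) ℂ := Matrix.of ![a + b, n, w] with hMdef
  have hdet : M.det = (n ⬝ᵥ n) * (a ⬝ᵥ a - b ⬝ᵥ b) := by
    rw [show M.det = Matrix.det ![a + b, n, w] from rfl, ← triple_product_eq_det, hw,
      cross_cross_eq_smul_sub_smul', dotProduct_sub, dotProduct_smul, dotProduct_smul, smul_eq_mul,
      smul_eq_mul]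
    have h3 : (a - b) ⬝ᵥ n = 0 := by rw [sub_dotProduct, dotProduct_comm a, dotProduct_comm b, hna, hnb, sub_zero]
    have h4 : (a + b) ⬝ᵥ (a - b) = a ⬝ᵥ a - b ⬝ᵥ b := by
      simp only [add_dotProduct, dotProduct_sub, dotProduct_comm b a]; ring
    have h5 : (a + b) ⬝ᵥ n = 0 := by rw [add_dotProduct, dotProduct_comm a, dotProduct_comm b, hna, hnb, add_zero]
    rw [h3, h4, h5]
    ring
  have hdet0 : M.det ≠ 0 := by
    rw [hdet]
    exact mul_ne_zero hn (sub_ne_zero.2 hlen)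
  have hv' : (a + b) ⬝ᵥ v = 0 := by rw [dotProduct_comm]; exact hv
  have hvn' : n ⬝ᵥ v = 0 := by rw [dotProduct_comm]; exact hvn
  have hvw' : w ⬝ᵥ v = 0 := by rw [dotProduct_comm]; exact hvw
  have hMv : M *ᵥ v = 0 := by
    rw [hMdef, Matrix.cons_mulVec, Matrix.cons_mulVec, Matrix.cons_mulVec, Matrix.empty_mulVec,
      hv', hvn', hvw']
    simp
  exact Matrix.eq_zero_of_mulVec_eq_zero hdet0 hMv

/-- A complex vector splits into a part transverse to a nonzero integer `c` plus a multiple of `c`.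
[folklore] -/
theorem exists_transverse_add_smul (c : Fin 3 → ℤ) (hc : c ≠ 0) (w : Fin 3 → ℂ) :
    ∃ (w' : Fin 3 → ℂ) (t : ℂ), w' ⬝ᵥ (fun i : Fin 3 => (((c : Fin 3 → ℤ) i : ℤ) : ℂ)) = 0 ∧ w = w' + t • (fun i : Fin 3 => (((c : Fin 3 → ℤ) i : ℤ) : ℂ)) := by
  have hcc := castVec_dotProduct_self_ne_zero hc
  refine ⟨w - ((w ⬝ᵥ (fun i : Fin 3 => (((c : Fin 3 → ℤ) i : ℤ) : ℂ))) / ((fun i : Fin 3 => (((c : Fin 3 → ℤ) i : ℤ) : ℂ)) ⬝ᵥ (fun i : Fin 3 => (((c : Fin 3 → ℤ) i : ℤ) : ℂ)))) • (fun i : Fin 3 => (((c : Fin 3 → ℤ) i : ℤ) : ℂ)), (w ⬝ᵥ (fun i : Fin 3 => (((c : Fin 3 → ℤ) i : ℤ) : ℂ))) / ((fun i : Fin 3 => (((c : Fin 3 → ℤ) i : ℤ) : ℂ)) ⬝ᵥ (fun i : Fin 3 => (((c : Fin 3 → ℤ) i : ℤ) : ℂ))), ?_, by abel⟩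
  rw [sub_dotProduct, smul_dotProduct, smul_eq_mul, div_mul_cancel₀ _ hcc, sub_self]

/-- A matrix killing every vector transverse to a nonzero integer `c`, and `c` itself, is zero.
[folklore] -/
theorem matrix_eq_zero_of_mulVec_transverse (c : Fin 3 → ℤ) (hc : c ≠ 0)
    (M : Matrix (Fin 3) (Fin 3) ℂ) (hMc : M *ᵥ (fun i : Fin 3 => (((c : Fin 3 → ℤ) i : ℤ) : ℂ)) = 0)
    (h : ∀ w : Fin 3 → ℂ, w ⬝ᵥ (fun i : Fin 3 => (((c : Fin 3 → ℤ) i : ℤ) : ℂ)) = 0 → M *ᵥ w = 0) : M = 0 := by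
  have hall : ∀ w : Fin 3 → ℂ, M *ᵥ w = 0 := fun w => by
    obtain ⟨w', t, hw', rfl⟩ := exists_transverse_add_smul c hc w
    rw [Matrix.mulVec_add, Matrix.mulVec_smul, hMc, smul_zero, add_zero, h w' hw']
  ext i j
  simpa [Matrix.mulVec, dotProduct, Pi.single_apply, Fin.sum_univ_three] using congrFun (hall (Pi.single j 1)) i

/-- **Block-killing lemma, block form.** An unequal non-collinear integer pair `(a, b)`, a nonzero
integer `c`, and a complex block `M` with `(a+b)ᵀ M = 0`, `M c = 0`: if every pair transfer of
`(a, b)` kills `M w` for every `w ⊥ c`, then `M = 0`. [folklore] -/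
theorem matrix_eq_zero_of_forall_pair_transfer (a b c : Fin 3 → ℤ) (hn : a ⨯₃ b ≠ 0)
    (hlen : a ⬝ᵥ a ≠ b ⬝ᵥ b) (hc : c ≠ 0) (M : Matrix (Fin 3) (Fin 3) ℂ)
    (hrow : (fun i : Fin 3 => ((((a + b) : Fin 3 → ℤ) i : ℤ) : ℂ)) ᵥ* M = 0) (hcol : M *ᵥ (fun i : Fin 3 => (((c : Fin 3 → ℤ) i : ℤ) : ℂ)) = 0)
    (h : ∀ x y w : Fin 3 → ℂ, x ⬝ᵥ (fun i : Fin 3 => (((a : Fin 3 → ℤ) i : ℤ) : ℂ)) = 0 → y ⬝ᵥ (fun i : Fin 3 => (((b : Fin 3 → ℤ) i : ℤ) : ℂ)) = 0 → w ⬝ᵥ (fun i : Fin 3 => (((c : Fin 3 → ℤ) i : ℤ) : ℂ)) = 0 →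
      ((x ⬝ᵥ (fun i : Fin 3 => (((b : Fin 3 → ℤ) i : ℤ) : ℂ))) • y + (y ⬝ᵥ (fun i : Fin 3 => (((a : Fin 3 → ℤ) i : ℤ) : ℂ))) • x) ⬝ᵥ (M *ᵥ w) = 0) : M = 0 := by
  refine matrix_eq_zero_of_mulVec_transverse c hc M hcol fun w hw => ?_
  have hn' : ((fun i : Fin 3 => (((a : Fin 3 → ℤ) i : ℤ) : ℂ)) ⨯₃ (fun i : Fin 3 => (((b : Fin 3 → ℤ) i : ℤ) : ℂ))) ⬝ᵥ ((fun i : Fin 3 => (((a : Fin 3 → ℤ) i : ℤ) : ℂ)) ⨯₃ (fun i : Fin 3 => (((b : Fin 3 → ℤ) i : ℤ) : ℂ))) ≠ 0 := by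
    rw [castVec_cross_castVec]; exact castVec_dotProduct_self_ne_zero hn
  have hlen' : (fun i : Fin 3 => (((a : Fin 3 → ℤ) i : ℤ) : ℂ)) ⬝ᵥ (fun i : Fin 3 => (((a : Fin 3 → ℤ) i : ℤ) : ℂ)) ≠ (fun i : Fin 3 => (((b : Fin 3 → ℤ) i : ℤ) : ℂ)) ⬝ᵥ (fun i : Fin 3 => (((b : Fin 3 → ℤ) i : ℤ) : ℂ)) := by
    rw [castVec_dotProduct_castVec, castVec_dotProduct_castVec]; exact_mod_cast hlen
  refine eq_zero_of_forall_pair_transfer_complex ((fun i : Fin 3 => (((a : Fin 3 → ℤ) i : ℤ) : ℂ))) ((fun i : Fin 3 => (((b : Fin 3 → ℤ) i : ℤ) : ℂ))) (M *ᵥ w) hn' hlen' ?_ fun x y hx hy => ?_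
  · rw [dotProduct_comm, ← castVec_add, Matrix.dotProduct_mulVec, hrow, zero_dotProduct]
  · rw [dotProduct_comm]; exact h x y w hx hy hw

/-- **Equal lengths still feed the polarisation `a × b`.** For a non-collinear integer pair
`(a, b)` with normal `n = a × b`, if every pair transfer of `(a, b)` kills `M w`, then `nᵀ (M w) = 0`:
take `x = n`, `y = b × n`, whose transfer is `(n·n) n`. [folklore] -/
theorem normal_dotProduct_mulVec_eq_zero (a b : Fin 3 → ℤ) (hn : a ⨯₃ b ≠ 0)
    (M : Matrix (Fin 3) (Fin 3) ℂ) (w : Fin 3 → ℂ)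
    (h : ∀ x y : Fin 3 → ℂ, x ⬝ᵥ (fun i : Fin 3 => (((a : Fin 3 → ℤ) i : ℤ) : ℂ)) = 0 → y ⬝ᵥ (fun i : Fin 3 => (((b : Fin 3 → ℤ) i : ℤ) : ℂ)) = 0 →
      ((x ⬝ᵥ (fun i : Fin 3 => (((b : Fin 3 → ℤ) i : ℤ) : ℂ))) • y + (y ⬝ᵥ (fun i : Fin 3 => (((a : Fin 3 → ℤ) i : ℤ) : ℂ))) • x) ⬝ᵥ (M *ᵥ w) = 0) :
    (fun i : Fin 3 => ((((a ⨯₃ b) : Fin 3 → ℤ) i : ℤ) : ℂ)) ⬝ᵥ (M *ᵥ w) = 0 := by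
  set n : Fin 3 → ℂ := (fun i : Fin 3 => (((a : Fin 3 → ℤ) i : ℤ) : ℂ)) ⨯₃ (fun i : Fin 3 => (((b : Fin 3 → ℤ) i : ℤ) : ℂ)) with hndef
  have hcast : (fun i : Fin 3 => ((((a ⨯₃ b) : Fin 3 → ℤ) i : ℤ) : ℂ)) = n := by rw [hndef, castVec_cross_castVec]
  have hnn : n ⬝ᵥ n ≠ 0 := by rw [← hcast]; exact castVec_dotProduct_self_ne_zero hn
  have hna : n ⬝ᵥ (fun i : Fin 3 => (((a : Fin 3 → ℤ) i : ℤ) : ℂ)) = 0 := by rw [hndef, dotProduct_comm]; exact dot_self_cross _ _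
  have hnb : n ⬝ᵥ (fun i : Fin 3 => (((b : Fin 3 → ℤ) i : ℤ) : ℂ)) = 0 := by rw [hndef, dotProduct_comm]; exact dot_cross_self _ _
  have hyb : ((fun i : Fin 3 => (((b : Fin 3 → ℤ) i : ℤ) : ℂ)) ⨯₃ n) ⬝ᵥ (fun i : Fin 3 => (((b : Fin 3 → ℤ) i : ℤ) : ℂ)) = 0 := by rw [dotProduct_comm]; exact dot_self_cross _ _
  have habn : ((fun i : Fin 3 => (((b : Fin 3 → ℤ) i : ℤ) : ℂ)) ⨯₃ n) ⬝ᵥ (fun i : Fin 3 => (((a : Fin 3 → ℤ) i : ℤ) : ℂ)) = n ⬝ᵥ n := by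
    rw [dotProduct_comm, triple_product_permutation, triple_product_permutation, hndef]
  have h1 := h n ((fun i : Fin 3 => (((b : Fin 3 → ℤ) i : ℤ) : ℂ)) ⨯₃ n) hna hyb
  rw [hnb, zero_smul, zero_add, habn, smul_dotProduct, smul_eq_mul] at h1
  rw [hcast]
  rcases mul_eq_zero.1 h1 with h' | h'
  · exact absurd h' hnn
  · exact h'

/-- Three left annihilators `n₁, n₂, c` with nonzero determinant kill a vector. [folklore] -/
theorem eq_zero_of_three_dotProduct (n₁ n₂ c : Fin 3 → ℤ) (hdet : Matrix.det ![n₁, n₂, c] ≠ 0)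
    (x : Fin 3 → ℂ) (h₁ : (fun i : Fin 3 => (((n₁ : Fin 3 → ℤ) i : ℤ) : ℂ)) ⬝ᵥ x = 0) (h₂ : (fun i : Fin 3 => (((n₂ : Fin 3 → ℤ) i : ℤ) : ℂ)) ⬝ᵥ x = 0) (h₃ : (fun i : Fin 3 => (((c : Fin 3 → ℤ) i : ℤ) : ℂ)) ⬝ᵥ x = 0) : x = 0 := by
  set M : Matrix (Fin 3) (Fin 3) ℂ := Matrix.of ![(fun i : Fin 3 => (((n₁ : Fin 3 → ℤ) i : ℤ) : ℂ)), (fun i : Fin 3 => (((n₂ : Fin 3 → ℤ) i : ℤ) : ℂ)), (fun i : Fin 3 => (((c : Fin 3 → ℤ) i : ℤ) : ℂ))] with hMdef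
  have hM : (Int.castRingHom ℂ).mapMatrix (Matrix.of ![n₁, n₂, c]) = M := by
    ext i j; fin_cases i <;> simp [hMdef]
  have hdet' : M.det ≠ 0 := by
    rw [← hM, ← RingHom.map_det, eq_intCast, Int.cast_ne_zero]
    exact hdet
  have hMv : M *ᵥ x = 0 := by
    rw [hMdef, Matrix.cons_mulVec, Matrix.cons_mulVec, Matrix.cons_mulVec, Matrix.empty_mulVec, h₁, h₂, h₃]
    simp
  exact Matrix.eq_zero_of_mulVec_eq_zero hdet' hMv

end Summit.AnomalousDissipation.AnomalousDissipation.Theorems.MomentParityQuarticGate.AxialQuad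

namespace Summit.AnomalousDissipation.AnomalousDissipation.Theorems.MomentParityQuarticGate

-- the summit-side namespace repeats `AnomalousDissipation` by the tree's convention
set_option linter.dupNamespace false in
/-- **Registered sub-goal `axialQuad_kill` of stub S2q** (summary of this file): the block-killing lemma — an unequal non-collinear integer pair whose pair transfers kill `M w` for all transverse `w` kills the block `M`. [folklore] -/
theorem axialQuad_kill : ∀ (a b c : Fin 3 → ℤ), crossProduct a b ≠ 0 → a ⬝ᵥ a ≠ b ⬝ᵥ b → c ≠ 0 → ∀ (M : Matrix (Fin 3) (Fin 3) ℂ), Matrix.vecMul (fun i : Fin 3 => (((a + b : Fin 3 → ℤ) i : ℤ) : ℂ)) M = 0 → Matrix.mulVec M (fun i : Fin 3 => (((c : Fin 3 → ℤ) i : ℤ) : ℂ)) = 0 → (∀ x y w : Fin 3 → ℂ, x ⬝ᵥ (fun i : Fin 3 => (((a : Fin 3 → ℤ) i : ℤ) : ℂ)) = 0 → y ⬝ᵥ (fun i : Fin 3 => (((b : Fin 3 → ℤ) i : ℤ) : ℂ)) = 0 → w ⬝ᵥ (fun i : Fin 3 => (((c : Fin 3 → ℤ) i : ℤ) : ℂ))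 = 0 → ((x ⬝ᵥ (fun i : Fin 3 => (((b : Fin 3 → ℤ) i : ℤ) : ℂ))) • y + (y ⬝ᵥ (fun i : Fin 3 => (((a : Fin 3 → ℤ) i : ℤ) : ℂ))) • x) ⬝ᵥ (Matrix.mulVec M w) = 0) → M = 0 :=
  AxialQuad.matrix_eq_zero_of_forall_pair_transfer

end Summit.AnomalousDissipation.AnomalousDissipation.Theorems.MomentParityQuarticGate
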